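import Summits.AtomisticToContinuum.Crystallization.Theorems.ReggeStarCoercivityDefectFreeCrystallizesLayeredGluing12

/-!
# Part 13 of the proof of `stub_layeredGluing : LayeredGluing` (S5a, line `prestress-split-korn`, crux stmt-AtomisticToContinuum-13603); see the module docstring of the final part `ReggeStarCoercivityDefectFreeCrystallizesLayeredGluing.lean` for the overview
-/

noncomputable section

open scoped BigOperators Classical InnerProductSpace
open Filter Topology

namespace Summit.AtomisticToContinuum.Crystallization.Theorems.PrestressSplitKorn

open Summit.AtomisticToContinuum.Crystallization.Theses
open Summit.AtomisticToContinuum.Crystallization.Theses.ReggeStarCoercivity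
open Summit.AtomisticToContinuum.Crystallization.Theorems.DefectFreeCrystallizes.Negative.PredicateAPI
open Literature.MathematicalPhysics.StatisticalMechanics Literature.Geometry.DiscreteGeometry


section Sites

variable {a : ℝ} {s : ℤ → ℤ} {z : ℤ → ℝ}

section StageA

variable {a : ℝ} {s : ℤ → ℤ} {z : ℤ → ℝ} {Y : Set (EuclideanSpace ℝ (Fin 3))} {x : EuclideanSpace ℝ (Fin 3)} {xe : ℤ × ℤ × ℤ}
  {E : EuclideanSpace ℝ (Fin 3) ≃ₗᵢ[ℝ] (EuclideanSpace ℝ (Fin 3))} {a' : ℝ} {s' : ℤ → ℤ} {z' : ℤ → ℝ}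

/-- The eleven known vectors at the in-plane neighbour `x + e`: all neighbour sites but `e` itself. -/
theorem sa_mem (hx : FramedAt a Y x s z) (hxe : xe ∈ hexLabels) {l : ℤ × ℤ × ℤ}
    (hl : l ∈ nbrLabels s) (hne : l ≠ xe) : x + layeredPos a s z xe + layeredPos a s z l ∈ Y := by
  obtain ⟨hbox, hs, hz0, -, h2⟩ := hx
  have := h2 (l + xe) (norm_nbr_add_hex_lt hbox hs hz0 hl hxe hne)
  rw [layeredPos_add_hex hz0 hxe] at this
  convert this using 1; abel

/-- The label correspondence at an in-plane neighbour (eleven labels). -/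
theorem sa_exists_phi (hx : FramedAt a Y x s z) (hxe : xe ∈ hexLabels)
    (hT : TemplateAt Y (x + layeredPos a s z xe) E a' s' z') :
    ∃ φ : ℤ × ℤ × ℤ → ℤ × ℤ × ℤ, (∀ l ∈ nbrLabels s, l ≠ xe → φ l ∈ nbrLabels s' ∧
      E (layeredPos a' s' z' (φ l)) = layeredPos a s z l) ∧
      (∀ l₁ ∈ nbrLabels s, ∀ l₂ ∈ nbrLabels s, l₁ ≠ xe → l₂ ≠ xe → φ l₁ = φ l₂ → l₁ = l₂) := by
  have hbox := hx.1
  have hs := hx.2.1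
  have hz0 := hx.2.2.1
  obtain ⟨hbox', hs', hz0', hN1, -⟩ := hT
  have key : ∀ l, ∃ l', (l ∈ nbrLabels s ∧ l ≠ xe) → l' ∈ nbrLabels s' ∧
      E (layeredPos a' s' z' l') = layeredPos a s z l := by
    intro l
    by_cases hl : l ∈ nbrLabels s ∧ l ≠ xe
    · have hn := norm_nbrSite hbox hs hz0 hl.1
      have hmem := sa_mem hx hxe hl.1 hl.2
      obtain ⟨l', hl'⟩ := hN1 _ hmem (by rw [dist_eq_norm, add_sub_cancel_left]; linarith [hn.2])
      have he : E (layeredPos a' s' z' l') = layeredPos a s z l := by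
        have := hl'; rw [add_right_inj] at this; exact this.symm
      refine ⟨l', fun _ => ⟨?_, he⟩⟩
      have hn' : ‖layeredPos a' s' z' l'‖ = ‖layeredPos a s z l‖ := by
        rw [← he, LinearIsometryEquiv.norm_map]
      have hl'0 : l' ≠ 0 := by
        intro h0
        rw [h0, show (0 : ℤ × ℤ × ℤ) = ((0 : ℤ), (0 : ℤ), (0 : ℤ)) from rfl, layeredPos_origin hz0',
          norm_zero] at hn'
        linarith [hn.1, hbox.a_pos]
      exact mem_nbrLabels.2 (mem_labels_of_norm_le hbox' hs' hz0' hl'0 (by linarith [hn.2]))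
    · exact ⟨0, fun h => absurd h hl⟩
  choose φ hφ using key
  refine ⟨φ, fun l hl hne => hφ l ⟨hl, hne⟩, ?_⟩
  intro l₁ h₁ l₂ h₂ hn₁ hn₂ heq
  have e1 := (hφ l₁ ⟨h₁, hn₁⟩).2
  have e2 := (hφ l₂ ⟨h₂, hn₂⟩).2
  rw [heq] at e1
  exact layeredPos_injective_of_inBox hbox (e1.symm.trans e2)

/-- **Tilted templates at an in-plane neighbour are cubic-ideal.** `f, g` are two hexagon labels
independent of each other and of `± xe`. -/
theorem sa_tilted_cubic' (hx : FramedAt a Y x s z) (hxe : xe ∈ hexLabels)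
    (hT : TemplateAt Y (x + layeredPos a s z xe) E a' s' z')
    (htilt : E.symm (layerNormal 1) ≠ layerNormal 1 ∧ E.symm (layerNormal 1) ≠ -layerNormal 1)
    {f g : ℤ × ℤ × ℤ} (hf : f ∈ hexLabels) (hg : g ∈ hexLabels) (hfx : f ≠ xe) (hfx' : -f ≠ xe)
    (hgx : g ≠ xe) (hgx' : -g ≠ xe) (hfg : f ≠ g) (hfg' : g ≠ -f) :
    a' = a ∧ CubicAt a s' z' := by
  obtain ⟨φ, hφ, hinj⟩ := sa_exists_phi hx hxe hT
  obtain ⟨hbox, hs, hz0, -, -⟩ := hx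
  obtain ⟨hbox', hs', hz0', -, -⟩ := hT
  set ν := E.symm (layerNormal 1) with hν
  have hνn : ‖ν‖ = 1 := norm_frame_normal E
  have ha := hbox.a_pos
  have hhex : ∀ l ∈ hexLabels, l ∈ nbrLabels s := fun l hl => mem_nbrLabels.2 (Or.inl hl)
  have horth : ∀ l ∈ hexLabels, l ≠ xe → ⟪layeredPos a' s' z' (φ l), ν⟫_ℝ = 0 := by
    intro l hl hne
    rw [← inner_frame_two, (hφ l (hhex l hl) hne).2, layeredPos_of_mem_hexLabels hz0 hl]
    simp [triangularVec₁, triangularVec₂]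
  have hnorm : ∀ l ∈ hexLabels, l ≠ xe → ‖layeredPos a' s' z' (φ l)‖ = a := by
    intro l hl hne
    rw [← LinearIsometryEquiv.norm_map E, (hφ l (hhex l hl) hne).2, norm_hexSite hbox hz0 hl]
  -- the hexagon lemma on five labels
  have hinjH : Set.InjOn φ (hexLabels.erase xe : Finset _) := by
    intro x hx y hy h
    rw [Finset.coe_erase, Set.mem_sdiff, Set.mem_singleton_iff] at hx hy
    exact hinj x (hhex x hx.1) y (hhex y hy.1) hx.2 hy.2 h
  have hFcard : 5 ≤ ((hexLabels.erase xe).image φ).card := by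
    rw [Finset.card_image_of_injOn hinjH, Finset.card_erase_of_mem hxe]; decide
  obtain ⟨haa, hz1sq, hzm1sq⟩ := hexagon_lemma hbox' hs' hz0' hνn htilt ha (by linarith [hbox.2.1])
    ((hexLabels.erase xe).image φ) hFcard
    (fun l' hl' => by
      obtain ⟨l, hl, rfl⟩ := Finset.mem_image.1 hl'
      exact hnorm l (Finset.mem_of_mem_erase hl) (Finset.ne_of_mem_erase hl))
    (fun l' hl' => by
      obtain ⟨l, hl, rfl⟩ := Finset.mem_image.1 hl'
      exact horth l (Finset.mem_of_mem_erase hl) (Finset.ne_of_mem_erase hl))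
  have hz1pos : 0 < z' 1 := by have := (hbox'.z_one hz0').1; linarith [hbox'.a_pos]
  have hzm1neg : z' (-1) < 0 := by have := (hbox'.z_neg_one hz0').1; linarith [hbox'.a_pos]
  have hanti : ∀ l ∈ hexLabels, l ≠ xe → -l ≠ xe →
      layeredPos a' s' z' (φ (-l)) = -layeredPos a' s' z' (φ l) := by
    intro l hl hne hne'
    apply E.injective
    rw [map_neg, (hφ l (hhex l hl) hne).2, (hφ (-l) (hhex _ (neg_mem_hexLabels hl)) hne').2,
      layeredPos_neg_hex hz0 hl]
  have pair : ∀ l ∈ hexLabels, l ≠ xe → -l ≠ xe → (φ l ∈ upLabels (s' 0) ∨ φ l ∈ downLabels (s' (-1))) →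
      s' (-1) = s' 0 ∧ z' (-1) = -z' 1 := by
    intro l hl hne hne' hcase
    have hφnl := (hφ (-l) (hhex _ (neg_mem_hexLabels hl)) hne').1
    have han := hanti l hl hne hne'
    have h2 := congrArg (fun x : EuclideanSpace ℝ (Fin 3) => x 2) han
    simp only [PiLp.neg_apply, layeredPos_apply_two] at h2
    rcases hcase with hup | hdn
    · rw [upLabels_fst hup] at h2
      rcases mem_nbrLabels.1 hφnl with h | h | h
      · rw [hexLabels_fst h, hz0'] at h2; linarith
      · rw [upLabels_fst h] at h2; linarith
      · exact up_down_antipodal hbox' hs' hup h han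
    · rw [downLabels_fst hdn] at h2
      rcases mem_nbrLabels.1 hφnl with h | h | h
      · rw [hexLabels_fst h, hz0'] at h2; linarith
      · exact up_down_antipodal hbox' hs' h hdn (by rw [han, neg_neg])
      · rw [downLabels_fst h] at h2; linarith
  have hcub : s' (-1) = s' 0 ∧ z' (-1) = -z' 1 := by
    by_cases hu : φ f ∈ hexLabels
    · by_cases hv : φ g ∈ hexLabels
      · exfalso
        have o1 := horth _ hf hfx
        have o2 := horth _ hg hgx
        rw [layeredPos_of_mem_hexLabels hz0' hu] at o1
        rw [layeredPos_of_mem_hexLabels hz0' hv] at o2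
        have hdet : ((φ f).2.1 : ℝ) * (φ g).2.2 - (φ g).2.1 * (φ f).2.2 ≠ 0 := by
          have hdet' : (φ f).2.1 * (φ g).2.2 - (φ g).2.1 * (φ f).2.2 ≠ 0 := by
            intro h0
            rcases hex_det2 _ hu _ hv h0 with h | h
            · exact hfg (hinj f (hhex f hf) g (hhex g hg) hfx hgx h.symm)
            · have e1 := (hφ _ (hhex _ hg) hgx).2
              rw [h, layeredPos_neg_hex hz0' hu, map_neg, (hφ _ (hhex _ hf) hfx).2,
                ← layeredPos_neg_hex hz0 hf] at e1
              exact hfg' (layeredPos_injective_of_inBox hbox e1).symm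
          exact_mod_cast hdet'
        have := nu_vertical hbox'.a_pos.ne' hdet o1 o2
        rcases eq_layerNormal_of_horizontal_zero hνn this.1 this.2 with h' | h'
        · exact htilt.1 h'
        · exact htilt.2 h'
      · exact pair _ hg hgx hgx' ((mem_nbrLabels.1 (hφ _ (hhex _ hg) hgx).1).resolve_left hv)
    · exact pair _ hf hfx hfx' ((mem_nbrLabels.1 (hφ _ (hhex _ hf) hfx).1).resolve_left hu)
  subst haa
  refine ⟨rfl, hcub.1, ?_, ?_⟩
  · exact eq_sqrt_two_thirds_mul hz1pos ha hz1sq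
  · rw [hcub.2, eq_sqrt_two_thirds_mul hz1pos ha hz1sq]

/-- Two hexagon labels independent of each other and of `± xe`. -/
theorem exists_indep_pair (hxe : xe ∈ hexLabels) : ∃ f g : ℤ × ℤ × ℤ, f ∈ hexLabels ∧ g ∈ hexLabels ∧
    f ≠ xe ∧ -f ≠ xe ∧ g ≠ xe ∧ -g ≠ xe ∧ f ≠ g ∧ g ≠ -f := by
  simp only [hexLabels, Finset.mem_insert, Finset.mem_singleton] at hxe
  rcases hxe with rfl | rfl | rfl | rfl | rfl | rfl
  · exact ⟨(0, 0, 1), (0, 1, -1), by decide, by decide, by decide, by decide, by decide, by decide, by decide, by decide⟩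
  · exact ⟨(0, 0, 1), (0, 1, -1), by decide, by decide, by decide, by decide, by decide, by decide, by decide, by decide⟩
  · exact ⟨(0, 1, 0), (0, 1, -1), by decide, by decide, by decide, by decide, by decide, by decide, by decide, by decide⟩
  · exact ⟨(0, 1, 0), (0, 1, -1), by decide, by decide, by decide, by decide, by decide, by decide, by decide, by decide⟩
  · exact ⟨(0, 1, 0), (0, 0, 1), by decide, by decide, by decide, by decide, by decide, by decide, by decide, by decide⟩
  · exact ⟨(0, 1, 0), (0, 0, 1), by decide, by decide, by decide, by decide, by decide, by decide, by decide, by decide⟩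

/-- **The base template is cubic-ideal too** (tilted in-plane case). -/
theorem sa_tilted_cubic (hx : FramedAt a Y x s z) (hxe : xe ∈ hexLabels)
    (hT : TemplateAt Y (x + layeredPos a s z xe) E a' s' z')
    (htilt : E.symm (layerNormal 1) ≠ layerNormal 1 ∧ E.symm (layerNormal 1) ≠ -layerNormal 1) :
    a' = a ∧ CubicAt a s' z' ∧ CubicAt a s z := by
  obtain ⟨f, g, hf, hg, hfx, hfx', hgx, hgx', hfg, hfg'⟩ := exists_indep_pair hxe
  obtain ⟨haa, hc'⟩ := sa_tilted_cubic' hx hxe hT htilt hf hg hfx hfx' hgx hgx' hfg hfg'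
  subst a'
  refine ⟨rfl, hc', ?_⟩
  obtain ⟨φ, hφ, -⟩ := sa_exists_phi hx hxe hT
  obtain ⟨hbox, hs, hz0, hK, -⟩ := hx
  obtain ⟨hbox', hs', hz0', -, hN2⟩ := hT
  have ha := hbox.a_pos
  have hup0 : ((1 : ℤ), (0 : ℤ), (0 : ℤ)) ∈ upLabels (s 0) := by simp [upLabels]
  have hl0 : ((1 : ℤ), (0 : ℤ), (0 : ℤ)) ∈ nbrLabels s := mem_nbrLabels.2 (Or.inr (Or.inl hup0))
  have hne0 : ((1 : ℤ), (0 : ℤ), (0 : ℤ)) ≠ xe := by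
    intro h; have := hexLabels_fst hxe; rw [← h] at this; simp at this
  obtain ⟨hφl, he⟩ := hφ _ hl0 hne0
  have hnorm : ‖layeredPos a s z (1, 0, 0)‖ = a := by
    rw [← he, LinearIsometryEquiv.norm_map]; exact norm_nbrSite_cubic hbox' hs' hz0' hc' hφl
  have hneg : layeredPos a s' z' (-φ (1, 0, 0)) = -layeredPos a s' z' (φ (1, 0, 0)) :=
    cubicAt_neg_site hz0' hc' (nbrLabels_fst_le hφl)
  set q := x + layeredPos a s z xe with hq
  have hmem : q + -layeredPos a s z (1, 0, 0) ∈ Y := by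
    have := hN2 (-φ (1, 0, 0)) (by rw [hneg, norm_neg, ← LinearIsometryEquiv.norm_map E, he, hnorm]; linarith [hbox.2.1])
    rwa [hneg, map_neg, he] at this
  have hz1 := hbox.z_one hz0
  -- exactness of the template at `x`
  have hmxe : -xe ∈ hexLabels := neg_mem_hexLabels hxe
  have hdist : dist (q + -layeredPos a s z (1, 0, 0)) x < 2 := by
    rw [dist_eq_norm, hq, show x + layeredPos a s z xe + -layeredPos a s z (1, 0, 0) - x =
      -(layeredPos a s z (1, 0, 0) + layeredPos a s z (-xe)) by rw [layeredPos_neg_hex hz0 hxe]; abel,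
      norm_neg, ← layeredPos_add_hex hz0 hmxe]
    exact norm_nbr_add_hex_lt hbox hs hz0 hl0 hmxe (by
      intro h; have := hexLabels_fst hmxe; rw [← h] at this; simp at this)
  obtain ⟨l₂', hl₂'⟩ := hK _ hmem hdist
  have hl₂ : -layeredPos a s z (1, 0, 0) = layeredPos a s z (l₂' + -xe) := by
    rw [layeredPos_add_hex hz0 hmxe, layeredPos_neg_hex hz0 hxe]
    have := hl₂'; rw [hq, add_assoc, add_right_inj] at this
    linear_combination (norm := module) this
  set l₂ := l₂' + -xe
  have hl₂n : ‖layeredPos a s z l₂‖ = a := by rw [← hl₂, norm_neg, hnorm]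
  have hl₂0 : l₂ ≠ 0 := by
    intro h0
    rw [h0, show (0 : ℤ × ℤ × ℤ) = ((0 : ℤ), (0 : ℤ), (0 : ℤ)) from rfl, layeredPos_origin hz0, norm_zero] at hl₂n
    linarith
  have hl₂mem := mem_labels_of_norm_le hbox hs hz0 hl₂0 (by linarith [hbox.2.1])
  have h2 := congrArg (fun x : EuclideanSpace ℝ (Fin 3) => x 2) hl₂
  simp only [PiLp.neg_apply, layeredPos_apply_two] at h2
  rcases hl₂mem with h | h | h
  · rw [hexLabels_fst h, hz0] at h2; linarith [hz1.1]
  · rw [upLabels_fst h] at h2; linarith [hz1.1]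
  · obtain ⟨hs1, hzz⟩ := up_down_antipodal hbox hs hup0 h hl₂.symm
    have hz1eq : z 1 = Real.sqrt (2 / 3) * a := by
      have hsq := norm_sq_upSite (a := a) (z := z) hs hup0
      rw [hnorm] at hsq
      exact eq_sqrt_two_thirds_mul (by linarith [hz1.1]) ha (by linarith)
    exact ⟨hs1, hz1eq, by rw [hzz, hz1eq]⟩

/-- **Vertical frame at an in-plane neighbour**: extend the correspondence to the missing label by
antipodes and re-express. -/
theorem sa_framed_of_vertical (hx : FramedAt a Y x s z) (hxe : xe ∈ hexLabels)
    (hT : TemplateAt Y (x + layeredPos a s z xe) E a' s' z')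
    (hvert : E.symm (layerNormal 1) = layerNormal 1 ∨ E.symm (layerNormal 1) = -layerNormal 1) :
    ∃ (s'' : ℤ → ℤ) (z'' : ℤ → ℝ), FramedAt a Y (x + layeredPos a s z xe) s'' z'' := by
  obtain ⟨φ, hφ, hinj⟩ := sa_exists_phi hx hxe hT
  have hbox := hx.1; have hs := hx.2.1; have hz0 := hx.2.2.1
  have hbox' := hT.1; have hz0' := hT.2.2.1
  have hhex : ∀ l ∈ hexLabels, l ∈ nbrLabels s := fun l hl => mem_nbrLabels.2 (Or.inl hl)
  have hmxe : -xe ∈ hexLabels := neg_mem_hexLabels hxe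
  have hxne : -xe ≠ xe := by
    intro h
    have h1 := congrArg (fun l : ℤ × ℤ × ℤ => l + xe) h
    simp only [neg_add_cancel] at h1
    have : (2 : ℤ) • xe = 0 := by rw [two_smul]; exact h1.symm
    have hxe0 : xe = 0 := by
      obtain ⟨m, i, j⟩ := xe
      simp only [Prod.smul_mk, smul_eq_mul, Prod.mk_eq_zero] at this ⊢
      omega
    exact nbrLabels_ne_zero (hhex _ hxe) hxe0
  -- heights are preserved up to sign, so known hexagon labels go to hexagon labels
  have habs : ∀ v : EuclideanSpace ℝ (Fin 3), |(E v) 2| = |v 2| := by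
    intro v
    rw [inner_frame_two, real_inner_fin3]
    rcases hvert with h | h <;> rw [h] <;> simp [layerNormal]
  have hφhex : ∀ l ∈ hexLabels, l ≠ xe → φ l ∈ hexLabels := by
    intro l hl hne
    obtain ⟨hmem, he⟩ := hφ l (hhex l hl) hne
    have h2 : z' (φ l).1 = 0 := by
      have := habs (layeredPos a' s' z' (φ l))
      rw [he] at this
      simp only [layeredPos_apply_two, hexLabels_fst hl, hz0, abs_zero] at this
      exact abs_eq_zero.1 this.symm
    have h1 : (φ l).1 = 0 := (hbox'.z_eq_zero_iff hz0' _).1 h2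
    rcases mem_nbrLabels.1 hmem with h | h | h
    · exact h
    · have := upLabels_fst h; omega
    · have := downLabels_fst h; omega
  -- extend `φ` to `xe` by the antipode of the image of `-xe`
  let ψ : ℤ × ℤ × ℤ → ℤ × ℤ × ℤ := fun l => if l = xe then -φ (-xe) else φ l
  have hψ : ∀ l ∈ hexLabels, ψ l ∈ nbrLabels s' ∧ E (layeredPos a' s' z' (ψ l)) = layeredPos a s z l := by
    intro l hl
    by_cases h : l = xe
    · subst h
      simp only [ψ, if_pos rfl]
      have hm := hφhex _ hmxe hxne
      refine ⟨mem_nbrLabels.2 (Or.inl (neg_mem_hexLabels hm)), ?_⟩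
      rw [layeredPos_neg_hex hz0' hm, map_neg, (hφ _ (hhex _ hmxe) hxne).2, layeredPos_neg_hex hz0 hxe, neg_neg]
    · simp only [ψ, if_neg h]
      exact hφ l (hhex l hl) h
  have hinjψ : Set.InjOn ψ hexLabels := by
    intro l₁ h₁ l₂ h₂ heq
    have e1 := (hψ l₁ h₁).2
    have e2 := (hψ l₂ h₂).2
    rw [heq] at e1
    exact layeredPos_injective_of_inBox hbox (e1.symm.trans e2)
  exact framed_of_vertical_core hbox hz0 hT hψ hinjψ hvert

/-! ### Case I: all templates cubic at their base -/

/-- In Case I the set is locally centrosymmetric at the neighbour scale. -/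
theorem caseI_antipode (hI : CaseI Y) (hE : ∀ q ∈ Y, ExactNear Y q) {b d : EuclideanSpace ℝ (Fin 3)} (hb : b ∈ Y)
    (hbd : b + d ∈ Y) (hd : ‖d‖ ≤ 11 / 10) (hd0 : d ≠ 0) : b - d ∈ Y := by
  obtain ⟨Et, a_t, st, zt, hT⟩ := exactNear_templateAt (hE b hb) hb
  have hc := hI b hb Et a_t st zt hT
  obtain ⟨hbox, hs, hz0, hN1, hN2⟩ := hT
  obtain ⟨l, hl⟩ := hN1 _ hbd (by rw [dist_eq_norm, add_sub_cancel_left]; linarith)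
  rw [add_right_inj] at hl
  have hn : ‖layeredPos a_t st zt l‖ = ‖d‖ := by rw [hl, LinearIsometryEquiv.norm_map]
  have hl0 : l ≠ 0 := by
    intro h0
    apply hd0
    rw [hl, h0, show (0 : ℤ × ℤ × ℤ) = ((0 : ℤ), (0 : ℤ), (0 : ℤ)) from rfl, layeredPos_origin hz0, map_zero]
  have hmem := mem_nbrLabels.2 (mem_labels_of_norm_le hbox hs hz0 hl0 (by rw [hn]; exact hd))
  have hneg := cubicAt_neg_site hz0 hc (nbrLabels_fst_le hmem)
  have := hN2 (-l) (by rw [hneg, norm_neg, hn]; linarith)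
  rwa [hneg, map_neg, ← hl, ← sub_eq_add_neg] at this

/-- Auxiliary step `two_sqrt_two_thirds_mem` of the proof of `stub_layeredGluing` (S5a); see the final part's module docstring. -/
theorem two_sqrt_two_thirds_mem (ha : 0 < a) :
    39 / 25 * a ≤ 2 * (Real.sqrt (2 / 3) * a) ∧ 2 * (Real.sqrt (2 / 3) * a) ≤ 17 / 10 * a := by
  have hb := sqrt_two_thirds_bounds
  constructor <;> nlinarith [hb.1, hb.2]

/-- Landing anchor of this file (registered stub of crux stmt-AtomisticToContinuum-13603; re-exports a result above). -/
theorem layeredGluing_part13_anchor :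
    ∀ (a : ℝ), 0 < a → 39 / 25 * a ≤ 2 * (Real.sqrt (2 / 3) * a) ∧ 2 * (Real.sqrt (2 / 3) * a) ≤ 17 / 10 * a :=
  fun _ h => two_sqrt_two_thirds_mem h

end StageA
end Sites

end Summit.AtomisticToContinuum.Crystallization.Theorems.PrestressSplitKorn
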